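import Summits.BirchSwinnertonDyer.BirchSwinnertonDyer.Theorems.TwoAdicConverseOrdLambdaHalfAtTwoPinnedDatumDefs
import Summits.BirchSwinnertonDyer.BirchSwinnertonDyer.Theorems.TwoAdicConverseOrdLambdaHalfAtTwoShapiroDatumDefs
import Literature.NumberTheory.EllipticCurves.IwasawaAlgebraDivisibilityProofs
import HarnessLib

/-!
# Crux `OrdLambdaHalfAtTwo` (stmt-BirchSwinnertonDyer-19556), line `kato_determinant_greenberg_two` v4.2 — NEGATIVE lemma on the
# supply stub 4′ `PinnedKatoGreenbergSupplyAtTwo`: the typed Poitou–Tate fields force `μ(𝐇¹_loc ⧸ loc(𝐇¹_Γ(T₂W) ⊕ 𝐇¹_Γ(T₂A))) ≤ μ(X_Gr)`,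
# so NO pinned Kato–Greenberg datum exists wherever the Shapiro defect has larger `μ` than `X_Gr` (the `{Δ_W < 0}` half of habitat (β),
# triage r1-1 Δ16-1/Δ17-1: `μ = 1` against `μ(X_Gr) = 0`)

Seat `cdisprove-stmt-BirchSwinnertonDyer-19556-g1` (refuter / standing disprover; cell `bsd-2adic`), `--supports stmt-BirchSwinnertonDyer-19556`;
closes nothing.  HONEST FRAMING: BSD is not proved by any of this; the crux `OrdLambdaHalfAtTwo` is neither proved nor refuted here; no
named fact, no definition, no `sorry`; kernel algebra over the v4 Defs (`PinnedKatoGreenbergDatum`, p674487).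

WHAT.  (1) `muInvariant_le_of_injective`: `μ` is monotone along injective `Λ`-linear maps into a finitely generated torsion module
(local length at `(p)` is monotone under localisation-exact injections and finite on the target).  (2) For every
`P : PinnedKatoGreenbergDatum …` with `X_Gr` finitely generated torsion, the field `δ_injective` gives
`μ(J.H ⧸ range(loc_W ⊕ u_A loc_A)) ≤ μ(DGr.X)` (`PinnedKatoGreenbergDatum.muInvariant_quot_le`).  (3) Hence the datum type is EMPTY as soon
as `μ(DGr.X) < μ(J.H ⧸ range(…))` (`isEmpty_pinnedKatoGreenbergDatum_of_muInvariant_lt`), and (4) the displayed binder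
`PinnedKatoGreenbergSupplyAtTwo` (stub 4′ of skeleton v4.2) is FALSE given any single admissible instance of its hypotheses at which
that strict inequality holds for all choices of the (pinned, hence essentially unique) carriers
(`pinnedKatoGreenbergSupplyAtTwo_false_of_muDefect`).
(5) (added after the lead's v4.3 reshape, Defs p679221) The SAME kernel constraint for the Shapiro-corrected datum: every
`S : ShapiroKatoGreenbergDatum …` with `X_Gr` finitely generated torsion has `μ(J.H ⧸ S.L) ≤ μ(DGr.X)`
(`muInvariant_quotL_le_of_shapiroKatoGreenbergDatum`), so the v4.3 supply stub 4″ `ShapiroKatoGreenbergSupplyAtTwo` needs, at every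
instance, a lattice `L` with `μ(𝐇¹_loc ⧸ L) ≤ μ(X_Gr)` (`= 0` under the line's B2) — the print input the genuine Shapiro lattice
`loc_w̄ H¹_Iw(K_Σ/K, T₂W)` supplies on both signs of `Δ_W` (triage r1-1 Δ17-1/Δ17-2) and the naive lattice `range(loc_W ⊕ u_A loc_A)` does
NOT on `{Δ_W < 0}` (whence (3)–(4)); `isEmpty_shapiroKatoGreenbergDatum_of_forall_muInvariant_lt` records the emptiness when NO
sandwiched lattice has small enough `μ`.

WHY IT BITES (print level, not asserted here — triage `TRIAGE-r1-1.md` GEN 17 Δ16-1/Δ17-1 and `Cruxes/OrdLambdaHalfAtTwo/Disproof.lean`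
§F7): the carriers are the tree's pinned objects, `𝐇¹_Γ(T₂W) ⊕ 𝐇¹_Γ(T₂A) → 𝐇¹_Iw(K_∞, T₂E)` is Shapiro's map with cokernel
`C ↪ 𝐇¹_Iw(ℚ_∞, E[2])` of `Ω`-rank `2 − dim E(ℝ)[2] = 1` on `{Δ_W < 0}` (modulo `μ(𝐇²) = 0`), and `loc` is injective on the `K_∞`-module
(cotorsion case), so `μ(J.H ⧸ range) ≥ 1` there while the line's B2 has `μ(X_Gr) = 0`: on that half of (β) stub 4′ as typed has no
witness and stub 6′ holds vacuously — the lead's announced repair is R1 (saturated lattice) / R2 (`lambda_PT` identity replacing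
`δ_injective ∧ exact_δ_π`).  This file is the kernel half of that finding; the print half is the hypothesis `hμ`.

References: K. Kato, Astérisque 295 (2004) §12.2, §17.13 [Kato2004Asterisque]; L. Washington, Introduction to Cyclotomic Fields, §13.2
[Washington1997]; R. Greenberg, V. Vatsal, Invent. Math. 142 (2000) §2 [GreenbergVatsal2000].
-/

set_option linter.dupNamespace false
set_option autoImplicit false

noncomputable section

open scoped Classical NumberField
open WeierstrassCurve NumberField IsDedekindDomain Field CategoryTheory
open Literature.NumberTheory.EllipticCurves Literature.NumberTheory.EllipticCurves.Rank1Residual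
open Literature.NumberTheory.EllipticCurves.Kato2004 Literature.NumberTheory.EllipticCurves.Kato2004.EulerSystemValues
open Literature.NumberTheory.GaloisRepresentations
open Summit.BirchSwinnertonDyer.Rank1Residual.X1.MuLambda (lam)
open Summit.BirchSwinnertonDyer.Rank1Residual.X11b (AcSelmer.bdpData AcSelmer.strictDatum)
open Summit.BirchSwinnertonDyer.BirchSwinnertonDyer.Theorems.TwoAdicKatoDeterminant

namespace Summit.BirchSwinnertonDyer.BirchSwinnertonDyer.Theorems.OrdLambdaHalfAtTwo.Negative

/-! ## §1 Algebra: `μ` is monotone along injections into finitely generated torsion `Λ`-modules -/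

section Algebra

variable {p : ℕ} [Fact p.Prime] {M N : Type*} [AddCommGroup M] [Module (IwasawaAlgebra p) M]
  [AddCommGroup N] [Module (IwasawaAlgebra p) N]

/-- `μ(M) ≤ μ(N)` for an injective `Λ`-linear `M → N` with `N` finitely generated torsion: the local length at `(p)` is monotone
along injections (localisation is exact) and finite for `N`. [cite: Washington1997, §13.2] -/
theorem muInvariant_le_of_injective [Module.Finite (IwasawaAlgebra p) N]
    (hN : Module.IsTorsion (IwasawaAlgebra p) N) (f : M →ₗ[IwasawaAlgebra p] N) (hf : Function.Injective f) :
    muInvariant p M ≤ muInvariant p N := by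
  let 𝔭 : PrimeSpectrum (IwasawaAlgebra p) := ⟨IwasawaAlgebra.augIdealP p, IwasawaAlgebra.isPrime_augIdealP_holds p⟩
  rw [muInvariant_eq_toNat_lengthAt p M 𝔭 rfl, muInvariant_eq_toNat_lengthAt p N 𝔭 rfl]
  exact ENat.toNat_le_toNat (Module.lengthAt_le_of_injective f hf 𝔭) (lengthAt_ne_top_of_isTorsion p N hN 𝔭 rfl)

end Algebra

/-! ## §2 The pinned datum: `μ` of the typed Poitou–Tate source is at most `μ(X_Gr)`; emptiness under a `μ`-defect -/

section Datum

variable {W : WeierstrassCurve ℚ} [W.IsElliptic] [ContinuousSMul ℤ_[2] (W.tateModule 2)]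
  {A : WeierstrassCurve ℚ} [A.IsElliptic] [ContinuousSMul ℤ_[2] (A.tateModule 2)]
  {κ : ZpExtension ℚ 2} {γ : absoluteGaloisGroup ℚ}
  {I_W : IwasawaH1Data W 2 κ γ} {I_A : IwasawaH1Data A 2 κ γ}
  {v : HeightOneSpectrum (𝓞 ℚ)} {γᵥ : absoluteGaloisGroup (v.adicCompletion ℚ)}
  {J : LocalIwasawaH1Data κ v ((tateRep W 2).toLocal v) γᵥ}
  {J' : LocalIwasawaH1Data κ v (tateLocalOrdinaryRep W 2 v) γᵥ}
  {J_A : LocalIwasawaH1Data κ v ((tateRep A 2).toLocal v) γᵥ}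
  {uA : ((tateRep A 2).toLocal v).toTopRep ⟶ ((tateRep W 2).toLocal v).toTopRep}
  {hsurj : Function.Surjective
    (κ.toContinuousMonoidHom.comp (resGalOfEmb (closureEmb (K := ℚ) (v.adicCompletion ℚ))))}
  {hγ : κ.IsTopGenerator γ}
  {hγᵥ : κ.IsTopGenerator (resGalOfEmb (closureEmb (K := ℚ) (v.adicCompletion ℚ)) γᵥ)}
  {K : Type} [Field K] [NumberField K] {κK : ZpExtension K 2} {γK : absoluteGaloisGroup K}
  {w : HeightOneSpectrum (𝓞 K)}
  {DGr : (W.baseChange K).GreenbergStrictSelmerDualData κK γK (AcSelmer.bdpData (MK W K) 2 w)}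
  {Dfi : (W.baseChange K).GreenbergStrictSelmerDualData κK γK (fineData W K)}
  {L₀ L₀' : IwasawaAlgebra 2} {b b' : ℕ}

/-- **`μ(𝐇¹_loc ⧸ loc(𝐇¹_Γ(T₂W) ⊕ 𝐇¹_Γ(T₂A))) ≤ μ(X_Gr)` for every pinned Kato–Greenberg datum** with `X_Gr` finitely generated
torsion: the typed Poitou–Tate field `δ` is an injective `Λ`-linear map from that quotient into `DGr.X`, and `μ` is monotone along
injections. [cite: Kato2004Asterisque, §17.13 (shape only)] -/
theorem muInvariant_quot_le_of_pinnedKatoGreenbergDatum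
    (P : PinnedKatoGreenbergDatum I_W I_A J J' J_A uA hsurj hγ hγᵥ DGr Dfi L₀ L₀' b b')
    (hX : Module.Finite (IwasawaAlgebra 2) DGr.X) (hXt : Module.IsTorsion (IwasawaAlgebra 2) DGr.X) :
    muInvariant 2 (J.H ⧸ LinearMap.range
      ((I_W.loc J hsurj hγ hγᵥ).coprod (J_A.map uA J ∘ₗ I_A.loc J_A hsurj hγ hγᵥ))) ≤ muInvariant 2 DGr.X := by
  haveI := hX
  exact muInvariant_le_of_injective hXt P.δ P.δ_injective

/-- **Emptiness under a `μ`-defect.** If `X_Gr` is finitely generated torsion and `μ(X_Gr) < μ(𝐇¹_loc ⧸ loc(𝐇¹_Γ(T₂W) ⊕ 𝐇¹_Γ(T₂A)))`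
(the `{Δ_W < 0}` half of habitat (β) at print level: Shapiro defect of `Ω`-rank `1` against `μ(X_Gr) = 0`), then there is NO pinned
Kato–Greenberg datum over these carriers, whatever `L₀, L₀', b, b'`. [cite: Kato2004Asterisque, §17.13 (shape only)] -/
theorem isEmpty_pinnedKatoGreenbergDatum_of_muInvariant_lt
    (hX : Module.Finite (IwasawaAlgebra 2) DGr.X) (hXt : Module.IsTorsion (IwasawaAlgebra 2) DGr.X)
    (hμ : muInvariant 2 DGr.X < muInvariant 2 (J.H ⧸ LinearMap.range
      ((I_W.loc J hsurj hγ hγᵥ).coprod (J_A.map uA J ∘ₗ I_A.loc J_A hsurj hγ hγᵥ)))) :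
    IsEmpty (PinnedKatoGreenbergDatum I_W I_A J J' J_A uA hsurj hγ hγᵥ DGr Dfi L₀ L₀' b b') :=
  ⟨fun P => (not_lt.mpr (muInvariant_quot_le_of_pinnedKatoGreenbergDatum P hX hXt)) hμ⟩

end Datum

/-! ## §3 Stub 4′ `PinnedKatoGreenbergSupplyAtTwo` is false at any admissible instance carrying the `μ`-defect -/

/-- **Stub 4′ (`PinnedKatoGreenbergSupplyAtTwo`, skeleton v4.2 of line `kato_determinant_greenberg_two`) is FALSE given ONE admissible
instance of its hypotheses at which, for every choice of the place data and of the (pinned) carriers, the typed Poitou–Tate source has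
larger `μ` than `X_Gr`.**  The hypothesis `hμ` is the print-level Shapiro `μ`-defect (triage r1-1 Δ16-1: every (β)-curve with `Δ_W < 0`,
modulo `μ(𝐇²) = 0` and the line's `μ(X_Gr) = 0`); nothing about any particular curve is asserted here.
[cite: Kato2004Asterisque, §12.2, §17.13 (shape only)] [cite: GreenbergVatsal2000, §2 (shape only)] -/
theorem pinnedKatoGreenbergSupplyAtTwo_false_of_muDefect
    (W : WeierstrassCurve ℚ) [W.IsElliptic] [W.IsGloballyMinimal]
    (hCM : ¬ W.HasCM) (hgood : GoodOrd W 2) (hred : ¬ W.HasIrreducibleModPGaloisRep 2)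
    (κ : ZpExtension ℚ 2) (γ : absoluteGaloisGroup ℚ) (hcyc : κ.IsCyclotomic) (hγ : κ.IsTopGenerator γ)
    (hvar : IsCyclotomicVariable 2 γ) (hord : IsOrdinaryAt W 2)
    [NeZero (W.conductorNorm ℤ)] (f : CuspForm (CongruenceSubgroup.Gamma0 (W.conductorNorm ℤ)) 2)
    (hf : ModularForms.IsNewformOf W f)
    (D : W.SelmerDualData κ γ) (L₀ : IwasawaAlgebra 2)
    (hL₀ : iwasawaToPowerSeries 2 L₀ = padicLFunction f (unitRoot W 2 : ℚ_[2]))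
    (K : Type) [Field K] [NumberField K]
    (hK : IsImaginaryQuadratic K ∧ SatisfiesHeegnerHypothesis (2 * W.conductorNorm ℤ) K)
    (A : WeierstrassCurve ℚ) [A.IsElliptic] [A.IsGloballyMinimal] (C : VariableChange ℚ)
    (hC : C • A = W.quadraticTwist ((NumberField.discr K : ℤ) : ℚ)) (hordA : IsOrdinaryAt A 2)
    [NeZero (A.conductorNorm ℤ)] (g : CuspForm (CongruenceSubgroup.Gamma0 (A.conductorNorm ℤ)) 2)
    (hg : ModularForms.IsNewformOf A g)
    (DA : A.SelmerDualData κ γ) (L₀' : IwasawaAlgebra 2)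
    (hL₀' : iwasawaToPowerSeries 2 L₀' = padicLFunction g (unitRoot A 2 : ℚ_[2]))
    (w : HeightOneSpectrum (𝓞 K)) (hw : ((2 : ℕ) : 𝓞 K) ∈ w.asIdeal)
    (κK : ZpExtension K 2) (γK : absoluteGaloisGroup K) (hcycK : κK.IsCyclotomic) (hγK : κK.IsTopGenerator γK)
    (DGr : (W.baseChange K).GreenbergStrictSelmerDualData κK γK (AcSelmer.bdpData (MK W K) 2 w))
    (Dfi : (W.baseChange K).GreenbergStrictSelmerDualData κK γK (fineData W K))
    (hfin : Module.Finite (IwasawaAlgebra 2) DGr.X ∧ Module.IsTorsion (IwasawaAlgebra 2) DGr.X)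
    [ContinuousSMul ℤ_[2] (W.tateModule 2)] [ContinuousSMul ℤ_[2] (A.tateModule 2)]
    (hμ : ∀ (v : HeightOneSpectrum (𝓞 ℚ)) (γᵥ : absoluteGaloisGroup (v.adicCompletion ℚ))
      (hsurj : Function.Surjective
        (κ.toContinuousMonoidHom.comp (resGalOfEmb (closureEmb (K := ℚ) (v.adicCompletion ℚ)))))
      (hγᵥ : κ.IsTopGenerator (resGalOfEmb (closureEmb (K := ℚ) (v.adicCompletion ℚ)) γᵥ))
      (I_W : IwasawaH1Data W 2 κ γ) (I_A : IwasawaH1Data A 2 κ γ)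
      (J : LocalIwasawaH1Data κ v ((tateRep W 2).toLocal v) γᵥ)
      (J' : LocalIwasawaH1Data κ v (tateLocalOrdinaryRep W 2 v) γᵥ)
      (J_A : LocalIwasawaH1Data κ v ((tateRep A 2).toLocal v) γᵥ)
      (uA : ((tateRep A 2).toLocal v).toTopRep ⟶ ((tateRep W 2).toLocal v).toTopRep),
      muInvariant 2 DGr.X < muInvariant 2 (J.H ⧸ LinearMap.range
        ((I_W.loc J hsurj hγ hγᵥ).coprod (J_A.map uA J ∘ₗ I_A.loc J_A hsurj hγ hγᵥ)))) :
    ¬ PinnedKatoGreenbergSupplyAtTwo := by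
  intro h
  obtain ⟨v, γᵥ, hsurj, hγᵥ, I_W, I_A, J, J', J_A, uA, ⟨P⟩⟩ :=
    h W hCM hgood hred κ γ hcyc hγ hvar hord f hf D L₀ hL₀ K hK A C hC hordA g hg DA L₀' hL₀' w hw κK γK hcycK hγK DGr Dfi hfin
  exact (isEmpty_pinnedKatoGreenbergDatum_of_muInvariant_lt hfin.1 hfin.2
    (hμ v γᵥ hsurj hγᵥ I_W I_A J J' J_A uA)).false P

/-! ## §4 The Shapiro-corrected datum (skeleton v4.3, Defs p679221): the same `μ`-constraint on the lattice `L` -/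

section Shapiro

variable {W : WeierstrassCurve ℚ} [W.IsElliptic] [ContinuousSMul ℤ_[2] (W.tateModule 2)]
  {A : WeierstrassCurve ℚ} [A.IsElliptic] [ContinuousSMul ℤ_[2] (A.tateModule 2)]
  {κ : ZpExtension ℚ 2} {γ : absoluteGaloisGroup ℚ}
  {I_W : IwasawaH1Data W 2 κ γ} {I_A : IwasawaH1Data A 2 κ γ}
  {v : HeightOneSpectrum (𝓞 ℚ)} {γᵥ : absoluteGaloisGroup (v.adicCompletion ℚ)}
  {J : LocalIwasawaH1Data κ v ((tateRep W 2).toLocal v) γᵥ}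
  {J' : LocalIwasawaH1Data κ v (tateLocalOrdinaryRep W 2 v) γᵥ}
  {J_A : LocalIwasawaH1Data κ v ((tateRep A 2).toLocal v) γᵥ}
  {uA : ((tateRep A 2).toLocal v).toTopRep ⟶ ((tateRep W 2).toLocal v).toTopRep}
  {hsurj : Function.Surjective
    (κ.toContinuousMonoidHom.comp (resGalOfEmb (closureEmb (K := ℚ) (v.adicCompletion ℚ))))}
  {hγ : κ.IsTopGenerator γ}
  {hγᵥ : κ.IsTopGenerator (resGalOfEmb (closureEmb (K := ℚ) (v.adicCompletion ℚ)) γᵥ)}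
  {K : Type} [Field K] [NumberField K] {κK : ZpExtension K 2} {γK : absoluteGaloisGroup K}
  {w : HeightOneSpectrum (𝓞 K)}
  {DGr : (W.baseChange K).GreenbergStrictSelmerDualData κK γK (AcSelmer.bdpData (MK W K) 2 w)}
  {Dfi : (W.baseChange K).GreenbergStrictSelmerDualData κK γK (fineData W K)}
  {L₀ L₀' : IwasawaAlgebra 2} {b b' : ℕ}

/-- **`μ(𝐇¹_loc ⧸ L) ≤ μ(X_Gr)` for every Shapiro-corrected Kato–Greenberg datum** with `X_Gr` finitely generated torsion (`L` its
Shapiro lattice): the typed Poitou–Tate field `δ : J.H ⧸ L ↪ X_Gr` and monotonicity of `μ`.  Under the line's `μ(X_Gr) = 0` any supply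
proof of 4″ must therefore exhibit a lattice with `μ(𝐇¹_loc ⧸ L) = 0`. [cite: Kato2004Asterisque, §17.13 (shape only)] -/
theorem muInvariant_quotL_le_of_shapiroKatoGreenbergDatum
    (S : ShapiroKatoGreenbergDatum I_W I_A J J' J_A uA hsurj hγ hγᵥ DGr Dfi L₀ L₀' b b')
    (hX : Module.Finite (IwasawaAlgebra 2) DGr.X) (hXt : Module.IsTorsion (IwasawaAlgebra 2) DGr.X) :
    muInvariant 2 (J.H ⧸ S.L) ≤ muInvariant 2 DGr.X := by
  haveI := hX
  exact muInvariant_le_of_injective hXt S.δ S.δ_injective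

/-- **Emptiness of the Shapiro-corrected datum type when NO sandwiched lattice has small `μ`**: if `X_Gr` is f.g. torsion and every
`Λ`-submodule `L` of `𝐇¹_loc` with `range(loc_W ⊕ u_A loc_A) ≤ L` and `2·L ≤ range(…)` has `μ(X_Gr) < μ(𝐇¹_loc ⧸ L)`, there is no
`ShapiroKatoGreenbergDatum` over these carriers.  (At print level the genuine Shapiro lattice violates the hypothesis — this is the
typed form of "4″ needs the `μ = 0` input for `𝐇¹_loc ⧸ loc_w̄ H¹_Iw(K_Σ/K, T)`", nothing more.) [cite: Kato2004Asterisque, §17.13 (shape only)] -/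
theorem isEmpty_shapiroKatoGreenbergDatum_of_forall_muInvariant_lt
    (hX : Module.Finite (IwasawaAlgebra 2) DGr.X) (hXt : Module.IsTorsion (IwasawaAlgebra 2) DGr.X)
    (hμ : ∀ L : Submodule (IwasawaAlgebra 2) J.H,
      LinearMap.range ((I_W.loc J hsurj hγ hγᵥ).coprod (J_A.map uA J ∘ₗ I_A.loc J_A hsurj hγ hγᵥ)) ≤ L →
      (∀ y ∈ L, (2 : IwasawaAlgebra 2) • y ∈
        LinearMap.range ((I_W.loc J hsurj hγ hγᵥ).coprod (J_A.map uA J ∘ₗ I_A.loc J_A hsurj hγ hγᵥ))) →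
      muInvariant 2 DGr.X < muInvariant 2 (J.H ⧸ L)) :
    IsEmpty (ShapiroKatoGreenbergDatum I_W I_A J J' J_A uA hsurj hγ hγᵥ DGr Dfi L₀ L₀' b b') :=
  ⟨fun S => (not_lt.mpr (muInvariant_quotL_le_of_shapiroKatoGreenbergDatum S hX hXt))
    (hμ S.L S.range_le S.two_smul_mem)⟩

end Shapiro

end Summit.BirchSwinnertonDyer.BirchSwinnertonDyer.Theorems.OrdLambdaHalfAtTwo.Negative

end
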